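import Summits.ResolutionOfSingularities.ResolutionOfSingularities.Theorems.FrobeniusLadderFInjectiveMacaulayficationHypersurfacePointBlowup
import Summits.ResolutionOfSingularities.ResolutionOfSingularities.Theorems.FrobeniusLadderFInjectiveMacaulayficationHypersurfaceRegular
import Summits.ResolutionOfSingularities.ResolutionOfSingularities.Theorems.FrobeniusLadderFInjectiveMacaulayficationClauseOfPderivNotMem
import Summits.ResolutionOfSingularities.ResolutionOfSingularities.Theorems.FrobeniusLadderFInjectiveMacaulayficationWildPinchFan
import Literature.AlgebraicGeometry.Motives.HypersurfaceFormsIrreducible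
import Mathlib.Algebra.MvPolynomial.Equiv
import Mathlib.Algebra.MvPolynomial.PDeriv
import Summits.ResolutionOfSingularities.ResolutionOfSingularities.Theorems.FrobeniusLadderFInjectiveMacaulayficationAS3PinchClosedCentre
import Summits.ResolutionOfSingularities.ResolutionOfSingularities.Theorems.FrobeniusLadderFInjectiveMacaulayficationFermatCubicConeChar2
import HarnessLib

/-!
# The crux statement for the cone over the supersingular cubic `y²z + yz² = x³` in characteristic `2` (first T-F cone instance)
# (crux `FInjectiveMacaulayfication` stmt-ResolutionOfSingularities-15315, chain w45a, door v30; line T-F under #4β, RULING R13.49 / R14.4 (2))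

[OURS · L1 W4.5a · res-L1-w45a-lead-1 gen 5] Support file (`--supports stmt-ResolutionOfSingularities-15315 --as helper`); NOT a
statement of any manuscript; AI-written, weaker than expert review.

`X = Spec k[x,y,z]/(f)`, `f = y²z + yz² + x³`, `char k = 2`: the affine cone over the supersingular plane cubic, an isolated
non-F-pure (`f ∈ 𝔪^{[2]}`) normal surface singularity at the vertex. ONE point blow-up resolves it — the exceptional curve is the
smooth cubic — and the engine `HypersurfacePointBlowup.hypersurfacePointBlowupFiModel` (point blow-ups of prime hypersurfaces,
res-L1-w45a-lead-1 c7) turns the four certificates into the CRUX STATEMENT for `X`: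
* `theta` — the strict transforms `g₀ = y²z + yz² + 1`, `g₁ = z + z² + x³`, `g₂ = y² + y + x³` (`θᵢ f = Xᵢ³·gᵢ`; the dehomogenised
  cubic, exceptional multiplicity `3`);
* `prime_cone` — `f ≅ T³ + C(y²z + yz²)` is irreducible (Eisenstein at the rational point `(1,1)` of `c = yz(y+z)`, where `c` vanishes in
  characteristic `2` and `∂c/∂y = z² = 1`; `Literature…SmoothHypersurface.irreducible_X_pow_add_C`), and `x ∤ f` (else `T ∣ C c`);
* `hoff` — off the vertex `X` is regular (`∂f/∂x = x²`, `∂f/∂y = z²`, `∂f/∂z = y²` in characteristic `2`);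
* `hpts` — the three chart surfaces are regular (`∂g₀/∂z = y²` with `y` a unit along `g₀ = y(yz+z²) + 1`; `∂g₁/∂z = ∂g₂/∂y = 1`);
* `fInjectiveMacaulayfication_supersingularCubicCone_char2` — `∃ X' → X` proper birational with every stalk a domain in which every
  system of parameters is weakly regular and generates a Frobenius-closed ideal.
[folklore mathematics; OURS as a certificate]
-/

-- single-problem summit: the doubled namespace component is forced
set_option linter.dupNamespace false

noncomputable section

namespace Summit.ResolutionOfSingularities.ResolutionOfSingularities.Theorems.FInjectiveMacaulayfication.CubicConeChar2

open MvPolynomial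
open Summit.ResolutionOfSingularities.ResolutionOfSingularities.Theorems.FInjectiveMacaulayfication
open Summit.ResolutionOfSingularities.ResolutionOfSingularities.Theorems.FInjectiveMacaulayfication.WildPinchClosedCentre

/-! ## §1 Strict transforms under the point blow-up -/

/-- **`θᵢ f = Xᵢ³ · gᵢ`** for the three charts of the blowing up of the origin of `𝔸³`. [folklore] -/
theorem theta (k : Type) [Field k] (f : MvPolynomial (Fin 3) k) (hf : f = X 1 ^ 2 * X 2 + X 1 * X 2 ^ 2 + X 0 ^ 3) :
    ∀ i : Fin 3, aeval (fun j : Fin 3 => if j = i then (X i : MvPolynomial (Fin 3) k) else X j * X i) f =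
      X i ^ 3 * (![X 1 ^ 2 * X 2 + X 1 * X 2 ^ 2 + 1, X 2 + X 2 ^ 2 + X 0 ^ 3, X 1 ^ 2 + X 1 + X 0 ^ 3] i) := by
  intro i
  rw [hf]
  fin_cases i <;> simp <;> ring

/-! ## §2 Primality and the variable conditions -/

/-- **`f = y²z + yz² + x³` is prime and `x ∤ f`** (char `2`): `k[X₀,X₁,X₂] ≃ k[Y₀,Y₁][T]`, `f ↦ T³ + C c`, `c = Y₀²Y₁ + Y₀Y₁²`;
`c(1,1) = 2 = 0`, `(∂c/∂Y₁)(1,1) = 1`, so `T³ + C c` is irreducible; and `T ∤ T³ + C c` since `c ≠ 0`. [folklore] -/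
theorem prime_cone (k : Type) [Field k] [CharP k 2] (f : MvPolynomial (Fin 3) k)
    (hf : f = X 1 ^ 2 * X 2 + X 1 * X 2 ^ 2 + X 0 ^ 3) : Prime f ∧ ¬ ((X 0 : MvPolynomial (Fin 3) k) ∣ f) := by
  set e : MvPolynomial (Fin 3) k ≃+* Polynomial (MvPolynomial (Fin 2) k) := (finSuccEquiv k 2).toRingEquiv with he_def
  have he0 : e (X 0) = Polynomial.X := finSuccEquiv_X_zero
  have he1 : e (X 1) = Polynomial.C (X 0) := finSuccEquiv_X_succ (j := 0)
  have he2 : e (X 2) = Polynomial.C (X 1) := finSuccEquiv_X_succ (j := 1)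
  set c : MvPolynomial (Fin 2) k := X 0 ^ 2 * X 1 + X 0 * X 1 ^ 2 with hc
  have hef : e f = Polynomial.X ^ 3 + Polynomial.C c := by
    rw [hf, hc]
    simp only [map_add, map_mul, map_pow, he0, he1, he2]
    ring
  have hpd : pderiv 1 c = X 0 ^ 2 := by
    have h : pderiv 1 c = X 0 ^ 2 + 2 * (X 0 * X 1) := by
      rw [hc]
      simp only [map_add, pderiv_mul, pderiv_pow, pderiv_X_self, pderiv_X_of_ne (show (0 : Fin 2) ≠ 1 by decide)]
      push_cast
      ring
    rw [h, (FermatCubicConeChar2.two_three k).1, zero_mul, add_zero]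
  have hder : MvPolynomial.eval (fun _ : Fin 2 => (1 : k)) (pderiv 1 c) ≠ 0 := by
    rw [hpd]
    simp
  have hcval : MvPolynomial.eval (fun _ : Fin 2 => (1 : k)) c = 0 := by
    rw [hc]
    simp only [map_add, map_mul, map_pow, eval_X, one_pow, mul_one]
    have h2 : (2 : k) = 0 := by simpa using CharP.cast_eq_zero k 2
    rw [show (1 : k) + 1 = 2 by norm_num, h2]
  have hirr : Irreducible (e f) := by
    rw [hef]
    exact Literature.AlgebraicGeometry.Motives.SmoothHypersurface.irreducible_X_pow_add_C (d := 3) (by norm_num) c _ hcval 1 hder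
  refine ⟨(MulEquiv.prime_iff e).mp hirr.prime, fun hdvd => ?_⟩
  have h1 : e (X 0) ∣ e f := map_dvd e hdvd
  rw [he0, hef, Polynomial.X_dvd_iff] at h1
  simp only [Polynomial.coeff_add, Polynomial.coeff_X_pow, Polynomial.coeff_C_zero] at h1
  simp at h1
  rw [h1, map_zero, map_zero] at hder
  exact hder rfl

/-! ## §3 The model -/

set_option maxHeartbeats 800000 in
/-- **THE CRUX STATEMENT FOR THE SUPERSINGULAR CUBIC CONE IN CHARACTERISTIC 2.** For every field `k` of characteristic `2` and
`X = Spec k[x,y,z]/(y²z + yz² + x³)` there is a proper birational `X' → X` (the blow-up of the vertex) all of whose stalks are domains in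
which every system of parameters is a weakly regular sequence generating a Frobenius-closed ideal. First T-F CONE instance
(res-L1-w45a-plan-1 R13.49 / R14.4 (2)), through the point-blow-up engine `HypersurfacePointBlowup.hypersurfacePointBlowupFiModel`.
[folklore mathematics; OURS as a certificate] -/
theorem fInjectiveMacaulayfication_supersingularCubicCone_char2 (k : Type) [Field k] [CharP k 2] (f : MvPolynomial (Fin 3) k)
    (hf : f = X 1 ^ 2 * X 2 + X 1 * X 2 ^ 2 + X 0 ^ 3) :
    ∃ (X' : AlgebraicGeometry.Scheme.{0}) (π : X' ⟶ AlgebraicGeometry.Spec (.of (MvPolynomial (Fin 3) k ⧸ Ideal.span {f}))),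
      AlgebraicGeometry.IsProper π ∧ Literature.AlgebraicGeometry.Resolution.IsBirational π ∧
      ∀ y : X', IsDomain (X'.presheaf.stalk y) ∧ ∀ d : ℕ, ringKrullDim (X'.presheaf.stalk y) = d →
        ∀ s : Fin d → X'.presheaf.stalk y, (Ideal.span (Set.range s)).radical.IsMaximal →
          RingTheory.Sequence.IsWeaklyRegular (X'.presheaf.stalk y) (List.ofFn s) ∧
          ∀ z : X'.presheaf.stalk y, (∃ e : ℕ, z ^ 2 ^ e ∈
              Ideal.span ((fun w : X'.presheaf.stalk y => w ^ 2 ^ e) ''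
                (Ideal.span (Set.range s) : Set (X'.presheaf.stalk y)))) →
            z ∈ Ideal.span (Set.range s) := by
  haveI : Fact (Nat.Prime 2) := ⟨Nat.prime_two⟩
  obtain ⟨hprime, hX0⟩ := prime_cone k f hf
  set g : Fin 3 → MvPolynomial (Fin 3) k := ![X 1 ^ 2 * X 2 + X 1 * X 2 ^ 2 + 1, X 2 + X 2 ^ 2 + X 0 ^ 3, X 1 ^ 2 + X 1 + X 0 ^ 3] with hg
  -- partial derivatives in characteristic 2
  have h23 := FermatCubicConeChar2.two_three k (n := 3)
  have hdf0 : pderiv 0 f = X 0 ^ 2 := by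
    rw [hf]
    simp only [map_add, pderiv_mul, pderiv_pow, pderiv_X_self, pderiv_X_of_ne (show (1 : Fin 3) ≠ 0 by decide),
      pderiv_X_of_ne (show (2 : Fin 3) ≠ 0 by decide)]
    push_cast
    linear_combination (X 0 ^ 2 : MvPolynomial (Fin 3) k) * h23.2
  have hdf1 : pderiv 1 f = X 2 ^ 2 := by
    rw [hf]
    simp only [map_add, pderiv_mul, pderiv_pow, pderiv_X_self, pderiv_X_of_ne (show (0 : Fin 3) ≠ 1 by decide),
      pderiv_X_of_ne (show (2 : Fin 3) ≠ 1 by decide)]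
    push_cast
    linear_combination (X 1 * X 2 : MvPolynomial (Fin 3) k) * h23.1
  have hdf2 : pderiv 2 f = X 1 ^ 2 := by
    rw [hf]
    simp only [map_add, pderiv_mul, pderiv_pow, pderiv_X_self, pderiv_X_of_ne (show (0 : Fin 3) ≠ 2 by decide),
      pderiv_X_of_ne (show (1 : Fin 3) ≠ 2 by decide)]
    push_cast
    linear_combination (X 1 * X 2 : MvPolynomial (Fin 3) k) * h23.1
  have hg0 : g 0 = X 1 ^ 2 * X 2 + X 1 * X 2 ^ 2 + 1 := by simp [hg]
  have hg1 : g 1 = X 2 + X 2 ^ 2 + X 0 ^ 3 := by simp [hg]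
  have hg2 : g 2 = X 1 ^ 2 + X 1 + X 0 ^ 3 := by simp [hg]
  have hdg0 : pderiv 2 (g 0) = X 1 ^ 2 := by
    rw [hg0]
    simp only [map_add, pderiv_one, pderiv_mul, pderiv_pow, pderiv_X_self, pderiv_X_of_ne (show (1 : Fin 3) ≠ 2 by decide)]
    push_cast
    linear_combination (X 1 * X 2 : MvPolynomial (Fin 3) k) * h23.1
  have hdg1 : pderiv 2 (g 1) = 1 := by
    rw [hg1]
    simp only [map_add, pderiv_pow, pderiv_X_self, pderiv_X_of_ne (show (0 : Fin 3) ≠ 2 by decide)]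
    push_cast
    linear_combination (X 2 : MvPolynomial (Fin 3) k) * h23.1
  have hdg2 : pderiv 1 (g 2) = 1 := by
    rw [hg2]
    simp only [map_add, pderiv_pow, pderiv_X_self, pderiv_X_of_ne (show (0 : Fin 3) ≠ 1 by decide)]
    push_cast
    linear_combination (X 1 : MvPolynomial (Fin 3) k) * h23.1
  refine HypersurfacePointBlowup.hypersurfacePointBlowupFiModel 2 k 3 f g 3
    ((Ideal.span_singleton_prime hprime.ne_zero).mpr hprime) (theta k f hf) ?_ ?_ ?_ ?_
  · -- `f ∉ (Xᵢ)`
    intro i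
    rw [Ideal.mem_span_singleton]
    fin_cases i
    · exact hX0
    · exact not_X_dvd_of_eval ![1, 0, 0] 1 rfl f (by rw [hf]; simp)
    · exact not_X_dvd_of_eval ![1, 0, 0] 2 rfl f (by rw [hf]; simp)
  · -- `gᵢ ∉ (Xᵢ)`
    intro i
    rw [Ideal.mem_span_singleton]
    fin_cases i
    · exact not_X_dvd_of_eval (fun _ => 0) 0 rfl _ (by simp [hg])
    · exact not_X_dvd_of_eval ![1, 0, 0] 1 rfl _ (by simp [hg])
    · exact not_X_dvd_of_eval ![1, 0, 0] 2 rfl _ (by simp [hg])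
  · -- off the vertex `X` is regular
    intro P hP hnot
    have hP' : (P.comap (Ideal.Quotient.mk (Ideal.span {f}))).IsPrime := Ideal.comap_isPrime _ _
    obtain ⟨_, ⟨j, rfl⟩, hj⟩ := Set.not_subset.mp (fun h => hnot (Ideal.span_le.mpr h))
    have hj' : (X j : MvPolynomial (Fin 3) k) ∉ P.comap (Ideal.Quotient.mk (Ideal.span {f})) := hj
    have hj2 : (X j : MvPolynomial (Fin 3) k) ^ 2 ∉ P.comap (Ideal.Quotient.mk (Ideal.span {f})) :=
      fun h => hj' (hP'.mem_of_pow_mem 2 h)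
    fin_cases j
    · exact HypersurfaceRegular.stub_hypersurfaceRegularOfPderiv k 3 f 0 P (by rw [hdf0]; exact hj2)
    · exact HypersurfaceRegular.stub_hypersurfaceRegularOfPderiv k 3 f 2 P (by rw [hdf2]; exact hj2)
    · exact HypersurfaceRegular.stub_hypersurfaceRegularOfPderiv k 3 f 1 P (by rw [hdf1]; exact hj2)
  · -- the chart surfaces are regular at their closed points on the exceptional divisor
    intro i Q hQ _
    fin_cases i
    · -- `g₀ = y²z + yz² + 1`: `y` is a unit along it, `∂g₀/∂z = y²`
      refine ClauseOfPderivNotMem.stub_clauseOfPderivNotMem 2 k 3 _ Q 2 ?_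
      change pderiv 2 (g 0) ∉ Ideal.comap (Ideal.Quotient.mk (Ideal.span {g 0})) Q
      rw [hdg0]
      intro h
      have hP : (Q.comap (Ideal.Quotient.mk (Ideal.span {g 0}))).IsPrime := Ideal.comap_isPrime _ _
      have hX1 := hP.mem_of_pow_mem 2 h
      have hg0mem : g 0 ∈ Q.comap (Ideal.Quotient.mk (Ideal.span {g 0})) := AS3Pinch.self_mem_comap (g 0) Q
      have hmem := sub_mem hg0mem (Ideal.mul_mem_right (X 1 * X 2 + X 2 ^ 2) _ hX1)
      rw [show g 0 - X 1 * (X 1 * X 2 + X 2 ^ 2) = (1 : MvPolynomial (Fin 3) k) by rw [hg0]; ring] at hmem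
      exact hP.ne_top ((Ideal.eq_top_iff_one _).mpr hmem)
    · refine ClauseOfPderivNotMem.stub_clauseOfPderivNotMem 2 k 3 _ Q 2 ?_
      change pderiv 2 (g 1) ∉ Ideal.comap (Ideal.Quotient.mk (Ideal.span {g 1})) Q
      rw [hdg1]
      exact fun h => (Ideal.comap_isPrime _ _ : (Q.comap _).IsPrime).ne_top ((Ideal.eq_top_iff_one _).mpr h)
    · refine ClauseOfPderivNotMem.stub_clauseOfPderivNotMem 2 k 3 _ Q 1 ?_
      change pderiv 1 (g 2) ∉ Ideal.comap (Ideal.Quotient.mk (Ideal.span {g 2})) Q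
      rw [hdg2]
      exact fun h => (Ideal.comap_isPrime _ _ : (Q.comap _).IsPrime).ne_top ((Ideal.eq_top_iff_one _).mpr h)

end Summit.ResolutionOfSingularities.ResolutionOfSingularities.Theorems.FInjectiveMacaulayfication.CubicConeChar2
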